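import Summits.Ventures.PercRepro.ClassPositive

/-!
# PercRepro — transport of connectivity and class sums along graph isomorphisms (typer-2, gen 4)

The (c1)–(c3) half of the «kernel-checked `C005UpTo 4`» spec (HANDOFF §typer-2 gen 4 → gen 5):
the class sums of a marked multigraph do not see

* the ORIENTATION of its edges (`SameEnds`: the same endpoint sets; `conn_iff_of_sameEnds`,
  `cubeSumQuad_eq_of_sameEnds`, `cubeSumC011_eq_of_sameEnds`);
* a RE-INDEXING of its edges (`mapEdges σ` along `σ : E ≃ E'`; `conn_mapEdges_iff`,
  `cubeSumQuad_mapEdges`, `cubeSumC011_mapEdges`);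
* an INJECTIVE renaming / padding of its vertices (`mapVertices ι`, the extra vertices isolated;
  `conn_mapVertices_iff`, `cubeSumQuad_mapVertices`, `cubeSumC011_mapVertices`).

So a census over graphs on `Fin N` (adjacency matrices, edges = the upper triangle) covers every
simple marked graph on `≤ N` vertices up to these three moves — (c4) identifies the edges of a
simple graph on `Fin N` with its upper triangle.
-/

namespace PercRepro

open Finset

namespace MultiGraph

/-! ### (c1) Orientation -/

section SameEnds

variable {V E : Type*}

/-- Two multigraphs on the same vertices and edges with the SAME ENDPOINT SETS (each edge carries
the same two endpoints, in either order). -/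
def SameEnds (G G' : MultiGraph V E) : Prop :=
  ∀ e, (G'.fst e = G.fst e ∧ G'.snd e = G.snd e) ∨ (G'.fst e = G.snd e ∧ G'.snd e = G.fst e)

/-- `SameEnds` is symmetric. -/
theorem SameEnds.symm {G G' : MultiGraph V E} (h : SameEnds G G') : SameEnds G' G := by
  intro e
  rcases h e with ⟨h1, h2⟩ | ⟨h1, h2⟩
  · exact Or.inl ⟨h1.symm, h2.symm⟩
  · exact Or.inr ⟨h2.symm, h1.symm⟩

/-- Open adjacency only depends on the endpoint sets. -/
theorem openAdj_of_sameEnds {G G' : MultiGraph V E} (h : SameEnds G G') {ω : Config E} {x y : V}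
    (hadj : G.OpenAdj ω x y) : G'.OpenAdj ω x y := by
  obtain ⟨e, he, hend⟩ := hadj
  refine ⟨e, he, ?_⟩
  rcases h e with ⟨h1, h2⟩ | ⟨h1, h2⟩
  · rw [h1, h2]
    exact hend
  · rw [h1, h2]
    exact hend.symm.imp And.symm And.symm

/-- Connectivity only depends on the endpoint sets. -/
theorem conn_iff_of_sameEnds {G G' : MultiGraph V E} (h : SameEnds G G') (ω : Config E)
    (x y : V) : G'.Conn ω x y ↔ G.Conn ω x y :=
  ⟨fun hc => Relation.ReflTransGen.mono (fun _ _ hab => openAdj_of_sameEnds h.symm hab) x y hc,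
    fun hc => Relation.ReflTransGen.mono (fun _ _ hab => openAdj_of_sameEnds h hab) x y hc⟩

/-- The marked partition only depends on the endpoint sets. -/
theorem markedPartition_eq_of_sameEnds {G G' : MultiGraph V E} (h : SameEnds G G') (ω : Config E)
    {k : ℕ} (m : Fin k → V) : G'.markedPartition ω m = G.markedPartition ω m := by
  ext i j
  exact conn_iff_of_sameEnds h ω (m i) (m j)

variable [Fintype E] [DecidableEq E]

/-- The class sums only depend on the endpoint sets (any kernel). -/
theorem cubeSumQuad_eq_of_sameEnds {G G' : MultiGraph V E} (h : SameEnds G G') {k : ℕ}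
    (m : Fin k → V) (A : Setoid (Fin k) → Setoid (Fin k) → ℝ) :
    G'.cubeSumQuad m A = G.cubeSumQuad m A := by
  unfold cubeSumQuad cubeSum
  simp only [markedPartition_eq_of_sameEnds h]

/-- The C-011 class sum only depends on the endpoint sets. -/
theorem cubeSumC011_eq_of_sameEnds {G G' : MultiGraph V E} (h : SameEnds G G') (m : Fin 4 → V) :
    G'.cubeSumC011 m = G.cubeSumC011 m := by
  unfold cubeSumC011 cubeSum
  simp only [markedPartition_eq_of_sameEnds h]

end SameEnds

/-! ### (c2) Re-indexing the edges -/

section MapEdges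

variable {V E E' : Type*} (G : MultiGraph V E)

/-- Re-index the edges along a bijection (endpoints carried along). -/
def mapEdges (σ : E ≃ E') : MultiGraph V E' where
  fst := G.fst ∘ σ.symm
  snd := G.snd ∘ σ.symm

/-- Open adjacency transports along the edge bijection. -/
theorem openAdj_mapEdges_iff (σ : E ≃ E') (ω : Config E) (x y : V) :
    (G.mapEdges σ).OpenAdj (ω ∘ σ.symm) x y ↔ G.OpenAdj ω x y := by
  constructor
  · rintro ⟨e', he', hend⟩
    exact ⟨σ.symm e', he', hend⟩
  · rintro ⟨e, he, hend⟩
    refine ⟨σ e, by simpa using he, ?_⟩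
    simpa [mapEdges] using hend

/-- Connectivity transports along the edge bijection. -/
theorem conn_mapEdges_iff (σ : E ≃ E') (ω : Config E) (x y : V) :
    (G.mapEdges σ).Conn (ω ∘ σ.symm) x y ↔ G.Conn ω x y :=
  ⟨fun hc => Relation.ReflTransGen.mono
      (fun a b hab => (G.openAdj_mapEdges_iff σ ω a b).mp hab) x y hc,
    fun hc => Relation.ReflTransGen.mono
      (fun a b hab => (G.openAdj_mapEdges_iff σ ω a b).mpr hab) x y hc⟩

/-- The marked partition transports along the edge bijection. -/
theorem markedPartition_mapEdges (σ : E ≃ E') (ω : Config E) {k : ℕ} (m : Fin k → V) :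
    (G.mapEdges σ).markedPartition (ω ∘ σ.symm) m = G.markedPartition ω m := by
  ext i j
  exact G.conn_mapEdges_iff σ ω (m i) (m j)

/-- The complement commutes with re-indexing. -/
theorem compl_comp_symm (σ : E ≃ E') (ω : Config E) : (ω ∘ σ.symm)ᶜ = ωᶜ ∘ σ.symm := by
  funext e'
  simp [Pi.compl_apply]

variable [Fintype E] [DecidableEq E] [Fintype E'] [DecidableEq E']

/-- The class sums are invariant under re-indexing the edges (any kernel). -/
theorem cubeSumQuad_mapEdges (σ : E ≃ E') {k : ℕ} (m : Fin k → V)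
    (A : Setoid (Fin k) → Setoid (Fin k) → ℝ) :
    (G.mapEdges σ).cubeSumQuad m A = G.cubeSumQuad m A := by
  unfold cubeSumQuad cubeSum
  symm
  refine Fintype.sum_equiv (Equiv.arrowCongr σ (Equiv.refl Bool)) _ _ fun ω => ?_
  have hω : (Equiv.arrowCongr σ (Equiv.refl Bool)) ω = ω ∘ σ.symm := by
    funext e'
    simp [Equiv.arrowCongr_apply]
  rw [hω]
  dsimp only
  rw [compl_comp_symm σ ω, G.markedPartition_mapEdges, G.markedPartition_mapEdges]

/-- The C-011 class sum is invariant under re-indexing the edges. -/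
theorem cubeSumC011_mapEdges (σ : E ≃ E') (m : Fin 4 → V) :
    (G.mapEdges σ).cubeSumC011 m = G.cubeSumC011 m := by
  unfold cubeSumC011 cubeSum
  symm
  refine Fintype.sum_equiv (Equiv.arrowCongr σ (Equiv.refl Bool)) _ _ fun ω => ?_
  have hω : (Equiv.arrowCongr σ (Equiv.refl Bool)) ω = ω ∘ σ.symm := by
    funext e'
    simp [Equiv.arrowCongr_apply]
  rw [hω]
  dsimp only
  rw [compl_comp_symm σ ω, G.markedPartition_mapEdges, G.markedPartition_mapEdges]

end MapEdges

/-! ### (c3) Injective vertex maps (renaming, padding by isolated vertices) -/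

section MapVertices

variable {V V' E : Type*} (G : MultiGraph V E)

/-- Push a multigraph forward along a vertex map (the same edges). -/
def mapVertices (ι : V → V') : MultiGraph V' E where
  fst := ι ∘ G.fst
  snd := ι ∘ G.snd

/-- Open adjacency pushes forward. -/
theorem openAdj_mapVertices (ι : V → V') {ω : Config E} {x y : V} (h : G.OpenAdj ω x y) :
    (G.mapVertices ι).OpenAdj ω (ι x) (ι y) := by
  obtain ⟨e, he, hend⟩ := h
  refine ⟨e, he, ?_⟩
  rcases hend with ⟨h1, h2⟩ | ⟨h1, h2⟩
  · exact Or.inl ⟨by simp [mapVertices, h1], by simp [mapVertices, h2]⟩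
  · exact Or.inr ⟨by simp [mapVertices, h1], by simp [mapVertices, h2]⟩

/-- **Connectivity transports along an injective vertex map**: a path between images stays in the
image (every edge endpoint is an image), so it lifts. -/
theorem conn_mapVertices_iff {ι : V → V'} (hι : Function.Injective ι) (ω : Config E) (x y : V) :
    (G.mapVertices ι).Conn ω (ι x) (ι y) ↔ G.Conn ω x y := by
  constructor
  · intro h
    suffices key : ∀ w : V', (G.mapVertices ι).Conn ω (ι x) w → ∀ y : V, w = ι y → G.Conn ω x y
      from key _ h y rfl
    intro w h
    unfold Conn at h
    induction h with
    | refl =>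
      intro y hy
      rw [hι hy]
      exact Conn.refl _ _ _
    | @tail w₁ w₂ _ hadj ih =>
      intro y hy
      obtain ⟨e, he, hend⟩ := hadj
      have hopen : G.Conn ω (G.fst e) (G.snd e) := Conn.of_openAdj (G.openAdj_of_open e he)
      rcases hend with ⟨h1, h2⟩ | ⟨h1, h2⟩
      · -- w₁ = ι (fst e), w₂ = ι (snd e) = ι y
        have hy' : G.snd e = y := hι (h2.trans hy)
        have h1' : G.Conn ω x (G.fst e) := ih (G.fst e) h1.symm
        rw [← hy']
        exact h1'.trans hopen
      · have hy' : G.fst e = y := hι (h1.trans hy)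
        have h1' : G.Conn ω x (G.snd e) := ih (G.snd e) h2.symm
        rw [← hy']
        exact h1'.trans hopen.symm
  · intro h
    unfold Conn at h ⊢
    induction h with
    | refl => exact Relation.ReflTransGen.refl
    | tail _ hbc ih => exact ih.tail (G.openAdj_mapVertices ι hbc)

/-- The marked partition transports along an injective vertex map (marks renamed). -/
theorem markedPartition_mapVertices {ι : V → V'} (hι : Function.Injective ι) (ω : Config E)
    {k : ℕ} (m : Fin k → V) :
    (G.mapVertices ι).markedPartition ω (ι ∘ m) = G.markedPartition ω m := by
  ext i j
  exact G.conn_mapVertices_iff hι ω (m i) (m j)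

variable [Fintype E] [DecidableEq E]

/-- The class sums are invariant under injective vertex maps (any kernel): renaming the vertices,
or adding isolated ones, changes nothing. -/
theorem cubeSumQuad_mapVertices {ι : V → V'} (hι : Function.Injective ι) {k : ℕ} (m : Fin k → V)
    (A : Setoid (Fin k) → Setoid (Fin k) → ℝ) :
    (G.mapVertices ι).cubeSumQuad (ι ∘ m) A = G.cubeSumQuad m A := by
  unfold cubeSumQuad cubeSum
  simp only [G.markedPartition_mapVertices hι]

/-- The C-011 class sum is invariant under injective vertex maps. -/
theorem cubeSumC011_mapVertices {ι : V → V'} (hι : Function.Injective ι) (m : Fin 4 → V) :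
    (G.mapVertices ι).cubeSumC011 (ι ∘ m) = G.cubeSumC011 m := by
  unfold cubeSumC011 cubeSum
  simp only [G.markedPartition_mapVertices hι]

end MapVertices

end MultiGraph

end PercRepro
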